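import Summits.QuantumFields.BalabanUV.T4Continuum.Support.NE9KernelGeometryTorus

/-!
# NE9KernelPointsOfRecord — THE POINT TYPE OF RECORD of the kernel species (O-NE9-1 item (ii), species (b): the fields `pts ∕ p0 ∕ dX ∕ ρd`
# that `NE9SpeciesDataOfRecord` (T19, p230386) left as parameters): ONE type hosting the unit lattices `T₁^{(j)}` of EVERY creation scale
# (the «sigma over scales» `NE9KernelGeometryTorus` §5 left to O-NE9-1), and the END of record's binders (G) `hgeom`, (S) `hsum0 ∕ hsum1`
# (+ `hρd hc0 hc1`) DISCHARGED at it with letters-only constants (cell `pub-balaban`, T4-DAG §2 node U3 ∕ §6 NE9; BINDER row NE9 OWNER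
# lineage `b2b-balaban-t4-ne9-p1`, generation 54; nothing of any import modified)

HONEST FRAMING (T4-DAG PAGE 1).  Rung (B)+1 of the FINITE-VOLUME T⁴ programme — NOT infinite volume, NOT a mass gap, NOT the Clay
problem.  NE9 (`T4OutputRate.NE9` ∧ `FadingMemory`) is a cell NEW ESTIMATE, NOT PRINTED in [I] = [Balaban1987RG1] (CMP **109**),
[II] = [Balaban1988RG2Cluster] (CMP **116**), NOT PROVED for Bałaban's E^{(j)} («NE9 ⇐ the named binders»; spine PROVED 0∕9).  HONEST
DEPENDENCY (cell line, verbatim): continuum YM on T⁴ ⇐ BetaPertH ∧ nine spine estimates (0/9 proved); BetaPertH ⇐ (D1) ∧ (D4) ∧ CAP+tail;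
G-an2-4 gates asym, D1 and NE2/3/4.  `FlowStep.BetaPertH`, (B), (B^μ) do not occur.  Finite-torus metric bookkeeping and two exponential
sums; no term, no activity, no history — NOT NE9, NOT summit progress; 0 sorry; [I] quoted for TYPES ∕ loci only (ABSOLUTE RULE).

WHERE THIS SITS.  The END of record (`NE9EndOfRecordReadOut.termSize_ne9_and_fadingMemory_readOut`, p236728) quantifies the kernel
species' point data `pts : ℕ → ι → SCube R → Finset Pt`, `p0 : Dom → Pt`, `dX : Dom → Pt → ℝ`, `ρd : Pt → Pt → ℝ` and DISPLAYS
  (G) `hgeom : ∀ k y a x, ∀ p q ∈ pts k y a, δ₁·ρd (p0 x.1) p + δ₁·ρd p q ≤ δ₀·(dX x.1 p + dX x.1 q) + w·d(x.1) + w₀`,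
  (S) `hsum0 : Σ_{p ∈ pts k y a} e^{−δ₁·ρd (p0 X) p} ≤ c₀`,  `hsum1 : ∀ p ∈ pts k y a, Σ_{q ∈ pts k y a} (ρd p q)^m·e^{−δ₁·ρd p q} ≤ c₁`,  `hρd hc0 hc1`
([I] p. 286: the sums over the points x, x₃ of (4.21), «δ₁ = O(M⁻¹)», c₀(δ₁), c₁(δ₁)).  `NE9KernelGeometryTorus` (p215818) proves (G), (S)
ONE SCALE AT A TIME on the sites `(ℤ∕(N_j·M))⁴` of `T₁^{(j)}`; this file supplies the global point type and the binders at it.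

LOCATED TYPING REMARK (O-ne9p1g54-1; record `t4/T4-EST-NE9-P1.md` §61; nothing landed is false).  In print the points of (4.21) live on
«the unit lattice T₁^{(j)}» of the SOURCE's creation scale j ([I] (4.19) p. 285), whereas `KerData.pts k y a` is indexed by step, table
coordinate and box only — not by the source `x ∈ 𝐃_j`.  A faithful points field therefore ranges over the sites of ALL scales at once;
the bilocal summand of record `ker … x … p q F` (O-NE9-1, not here) is the printed summand when `p.1 = q.1 = scale x` and `0` otherwise
(`KerData.dsum` = the printed double sum over `T₁^{(j)}`; `kerBound` reads `0 ≤ …` off-scale), and the distances take ONE conventional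
value `D R M` (`≥` the point count `V`, `≥` every same-scale periodic ℓ¹ distance) at off-scale pairs.  Then (G) holds with the crew's
letters UNCHANGED (`δ₁ := min (δ₀∕2) (w∕(2·(3·M·4)))`, `w₀ := w`) and (S) with print's constants PLUS the letters-only, lattice-uniform terms
`(e·δ₁)⁻¹` resp. `((m+1)∕(e·δ₁))^{m+1}` (`t^n e^{−δ₁t} ≤ (n∕(eδ₁))^n` at `t = D ≥ V`).  The alternative without conventional values is a
STRUCTURAL repair of `NE9Lemma1KernelSpecies.KerData` (scale-aware `pts`) through T3–T29, not done here (append-only); this file shows the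
repair is not NEEDED for the END's binders.

WHAT.  §1 `PtR R M := Σ j, TPt 4 (R.cubesPerDir j · M)`, `scales R := range (m + K + 1)`, **`ptsR`** (every site of every scale of record;
print's restriction to `□̄₄` is not needed by (S)), `toScale` (`ZMod.cast` reading at a scale; identity on the own scale), `V`, `D := V +
8·L^{m+K}·M`.  §2 **`ρdR`** (`pl1` on a common scale, `D` off-scale), `x0R ∕ p0R` (base corner site of a cube of `X`, on `X`'s scale),
**`dXR`** (`min_{□ ∈ X} dist(p, □)` on `X`'s scale, `D` off-scale).  §3 (G) `geom_record_same` (= `geom_carriersOfRecord` BY NAME),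
**`geom_record`** for ALL points, family form **`geom_record_family`** token-shaped like `hgeom`.  §4 (S) **`sum0_record`** `≤ c0R δ₁ :=
K₁ 4 δ₁ + (δ₁e)⁻¹`, **`sum1_record`** `≤ c1R δ₁ m := (2m∕(eδ₁))^m·K₁ 4 (δ₁∕2) + ((m+1)∕(δ₁e))^{m+1}` (own-scale fibre = the crew's torus sums
BY NAME; other fibres = `V·D^n e^{−δ₁D} ≤ D^{n+1}e^{−δ₁D}`), family forms `sum0_record_family ∕ sum1_record_family` (`pts := fun _ _ _ =>
ptsR R M`), `c0R_nonneg ∕ c1R_nonneg`, `delta1_record_pos`.  NOT DONE: `ker` ((4.20)–(4.30), O-NE9-1), (K) `kerBound`, any re-cut of the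
END (a consumer instantiates `𝔭.pts ∕ p0 ∕ dX ∕ ρd` with §1–§2 and feeds `hgeom hsum0 hsum1 hρd hc0 hc1` by the names here).

References (TYPES ∕ loci only): [Balaban1987RG1] T. Bałaban, CMP **109** (1987) 249–301: (0.1) p. 251, p. 257, (4.19) p. 285, (4.21)–(4.22)
pp. 285–286.  Summits-side NEW work (LEAN PLACEMENT RULE); imports `NE9KernelGeometryTorus` BY NAME; modifies nothing.  Value = one O-NE9-1
field typed with its END binders discharged + a located typing remark — bookkeeping on the row's instantiation path, NOT summit progress.
-/
noncomputable section

open scoped BigOperators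

namespace Summit.QuantumFields.BalabanUV.T4Continuum.NE9KernelPointsOfRecord

open Literature.MathematicalPhysics.QuantumFieldTheory.Balaban1983to89
open Literature.MathematicalPhysics.QuantumFieldTheory.Balaban1983to89.B12Decay510Torus
open Literature.MathematicalPhysics.QuantumFieldTheory.Balaban1983to89.B12Decay510Window (K₁ K₁_nonneg)
open Literature.MathematicalPhysics.QuantumFieldTheory.Balaban1983to89.TreeLengthTorus
open Summit.QuantumFields.BalabanUV.T4Continuum.NE9KernelGeometryTorus
open Summit.QuantumFields.BalabanUV.T4Continuum.NE9LatticeExpSums (pow_mul_exp_neg_le)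
open Summit.QuantumFields.BalabanUV.T4Continuum.NE9KernelGeometry (two_mul_delta1_le delta1_nonneg)

variable {Gg : Type} [GaugeGroup Gg] (R : B13Carriers.TwoRuns Gg) (M : ℕ) [NeZero M]

/-! ## §1 The point type of record: a sigma over creation scales -/

/-- [folklore] DATA: **THE POINT TYPE OF RECORD** — a creation scale `j` and a site of the unit lattice `T₁^{(j)}` of that scale, read as
`(ℤ∕(N_j·M))⁴` with `N_j = R.cubesPerDir j` cubes of `π_j` per direction and `M` sites per cube side ([I] (4.19) p. 285 «the unit lattice
T₁^{(j)}»; `NE9KernelGeometryTorus` §5). -/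
abbrev PtR : Type := Σ j : ℕ, TPt 4 (R.cubesPerDir j * M)

/-- [folklore] DATA: the creation scales of record, `j ≤ m + K` (the standing range of `Setup.Params`; beyond it the tori are junk). -/
def scales : Finset ℕ := Finset.range (R.F.m + R.K + 1)

/-- [folklore] `j ∈ scales R ↔ j ≤ m + K`. -/
theorem mem_scales {j : ℕ} : j ∈ scales R ↔ j ≤ R.F.m + R.K := by
  rw [scales, Finset.mem_range]; omega

/-- [folklore] DATA: **THE POINTS OF RECORD** — every site of every scale of record (print's sums over x, x₃ run over the sites of `□̄₄` in
`T₁^{(j)}`; the exponential sums (S) are bounded over the whole torus, so no restriction is recorded). [cite: Balaban1987RG1, (4.21) p.286] -/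
def ptsR : Finset (PtR R M) := (scales R).sigma fun j => (Finset.univ : Finset (TPt 4 (R.cubesPerDir j * M)))

/-- [folklore] Membership in the points of record is «scale of record». -/
theorem mem_ptsR {p : PtR R M} : p ∈ ptsR R M ↔ p.1 ≤ R.F.m + R.K := by
  obtain ⟨j, _⟩ := p; simp [ptsR, mem_scales]

/-- [folklore] DATA: the reading of a point of record AT SCALE `j` (coordinatewise `ZMod.cast`; used only on the point's own scale). -/
def toScale (j : ℕ) (p : PtR R M) : TPt 4 (R.cubesPerDir j * M) := fun i => ZMod.cast (p.2 i)

omit [NeZero M] in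
/-- [folklore] On its own scale the reading is the point itself. -/
@[simp] theorem toScale_self (j : ℕ) (s : TPt 4 (R.cubesPerDir j * M)) : toScale R M j ⟨j, s⟩ = s :=
  funext fun _ => ZMod.cast_id _ _

omit [NeZero M] in
/-- [folklore] A point whose scale is `j` IS its reading at scale `j` (sigma eta; avoids dependent rewriting). -/
theorem eq_mk_toScale {p : PtR R M} {j : ℕ} (h : p.1 = j) : p = ⟨j, toScale R M j p⟩ := by
  obtain ⟨i, s⟩ := p; simp only at h; subst h; simp

/-- [folklore] DATA: the number of points of record `V = Σ_{j ≤ m+K} (N_j·M)⁴`. -/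
def V : ℕ := (ptsR R M).card

/-- [folklore] `V = Σ_{j ∈ scales} #T₁^{(j)}`. -/
theorem V_eq_sum : (V R M : ℝ) = ∑ j ∈ scales R, (Fintype.card (TPt 4 (R.cubesPerDir j * M)) : ℝ) := by
  rw [V, ptsR, Finset.card_sigma, Nat.cast_sum]; simp only [Finset.card_univ]

/-- [folklore] DATA: **THE CONVENTIONAL OFF-SCALE VALUE** `D := V + 8·L^{m+K}·M` — at least the point count and at least every same-scale
periodic ℓ¹ distance (O-ne9p1g54-1: the value distances take at pairs of different scales). -/
def D : ℝ := (V R M : ℝ) + 8 * (R.F.L : ℝ) ^ (R.F.m + R.K) * M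

/-- [folklore] `V ≤ D`. -/
theorem V_le_D : (V R M : ℝ) ≤ D R M := by
  have : (0 : ℝ) ≤ 8 * (R.F.L : ℝ) ^ (R.F.m + R.K) * M := by positivity
  unfold D; linarith

/-- [folklore] `0 ≤ D`. -/
theorem D_nonneg : 0 ≤ D R M := (Nat.cast_nonneg _).trans (V_le_D R M)

/-- [folklore] The periodic ℓ¹ norm on `(ℤ∕T)^d` is at most `d·T` (each coordinate's least absolute residue is `≤ T∕2 ≤ T`). -/
theorem pl1_le_mul {d T : ℕ} [NeZero T] (x : TPt d T) : pl1 x ≤ (d : ℝ) * T := by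
  rw [pl1_eq_sum]
  have h : ∀ i, (pabs (x i) : ℝ) ≤ (T : ℝ) := fun i => by
    rw [pabs_eq_natAbs]
    exact_mod_cast (ZMod.natAbs_valMinAbs_le (x i)).trans (Nat.div_le_self T 2)
  calc ∑ i, (pabs (x i) : ℝ) ≤ ∑ _i : Fin d, (T : ℝ) := Finset.sum_le_sum fun i _ => h i
    _ = (d : ℝ) * T := by simp

omit [NeZero M] in
/-- [folklore] Every unit lattice of the family has at most `2·L^{m+K}·M` sites per direction (`N_j = 2·L^{m+K−(j+m')}`, truncated
subtraction). -/
theorem sites_le (j : ℕ) : (R.cubesPerDir j : ℝ) * M ≤ 2 * (R.F.L : ℝ) ^ (R.F.m + R.K) * M := by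
  have hL : 1 ≤ R.F.L := le_of_lt R.F.hL.2
  have h : R.cubesPerDir j ≤ 2 * R.F.L ^ (R.F.m + R.K) := by
    rw [B13Carriers.TwoRuns.cubesPerDir_eq]
    exact Nat.mul_le_mul_left 2 (Nat.pow_le_pow_right hL (Nat.sub_le _ _))
  have h' : (R.cubesPerDir j : ℝ) ≤ 2 * (R.F.L : ℝ) ^ (R.F.m + R.K) := by exact_mod_cast h
  exact mul_le_mul_of_nonneg_right h' (Nat.cast_nonneg M)

/-- [folklore] **Every same-scale periodic ℓ¹ distance is `≤ D`.** -/
theorem pl1_le_D (j : ℕ) (x : TPt 4 (R.cubesPerDir j * M)) : pl1 x ≤ D R M := by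
  have h1 := pl1_le_mul x
  push_cast at h1
  have h2 := sites_le R M j
  have hV : (0 : ℝ) ≤ V R M := Nat.cast_nonneg _
  unfold D; linarith

/-! ## §2 The distances and base points of record -/

/-- [folklore] DATA: **THE POINT DISTANCE OF RECORD** `ρd p q` — the periodic ℓ¹ distance `pl1 (p − q)` when `p`, `q` have the same scale
(print's `|x₃ − x|` on `T₁^{(j)}`, [I] p. 286), the conventional value `D` otherwise. [cite: Balaban1987RG1, (4.21) p.286] -/
def ρdR (p q : PtR R M) : ℝ := if p.1 = q.1 then pl1 (p.2 - toScale R M p.1 q) else D R M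

/-- [folklore] Same-scale reading of `ρdR`. -/
@[simp] theorem ρdR_same (j : ℕ) (s s' : TPt 4 (R.cubesPerDir j * M)) : ρdR R M ⟨j, s⟩ ⟨j, s'⟩ = pl1 (s - s') := by
  simp [ρdR]

/-- [folklore] Off-scale reading of `ρdR`. -/
theorem ρdR_off {p q : PtR R M} (h : p.1 ≠ q.1) : ρdR R M p q = D R M := by
  simp [ρdR, h]

/-- [folklore] `hρd`: **`0 ≤ ρd`**. -/
theorem ρdR_nonneg (p q : PtR R M) : 0 ≤ ρdR R M p q := by
  unfold ρdR; split_ifs; exacts [pl1_nonneg _, D_nonneg R M]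

/-- [folklore] `ρd ≤ D` everywhere. -/
theorem ρdR_le_D (p q : PtR R M) : ρdR R M p q ≤ D R M := by
  unfold ρdR; split_ifs; exacts [pl1_le_D R M _ _, le_rfl]

/-- [folklore] DATA: **THE BASE SITE OF RECORD** of a localization domain `X ∈ 𝐃_j`: the base corner site of (a choice of) one of its
cubes, on `X`'s own scale (print's «x₀ is a fixed point in X», [I] p. 286). [cite: Balaban1987RG1, (4.22) p.286] -/
def x0R (X : R.carriers.Dom) : TPt 4 (R.cubesPerDir X.1 * M) := base (R.cubesPerDir X.1) M (Classical.choose X.2.2.1)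

/-- [folklore] The base site lies in a cube of `X`. -/
theorem tcubeOf_x0R (X : R.carriers.Dom) : tcubeOf (R.cubesPerDir X.1) M (x0R R M X) ∈ X.2.1 := by
  rw [x0R, tcubeOf_base]
  exact Classical.choose_spec X.2.2.1

/-- [folklore] DATA: the base POINT of record `p0 X := ⟨scale X, x0R X⟩`. [cite: Balaban1987RG1, (4.22) p.286] -/
def p0R (X : R.carriers.Dom) : PtR R M := ⟨X.1, x0R R M X⟩

/-- [folklore] The base point has `X`'s scale. -/
@[simp] theorem p0R_fst (X : R.carriers.Dom) : (p0R R M X).1 = X.1 := rfl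

/-- [folklore] The distance of record from the base point to a point on `X`'s scale is the periodic ℓ¹ distance from the base site. -/
theorem ρdR_p0R (X : R.carriers.Dom) (s : TPt 4 (R.cubesPerDir X.1 * M)) :
    ρdR R M (p0R R M X) ⟨X.1, s⟩ = pl1 (x0R R M X - s) := by
  show (if X.1 = X.1 then pl1 (x0R R M X - toScale R M X.1 ⟨X.1, s⟩) else D R M) = _
  rw [if_pos rfl, toScale_self]

/-- [folklore] DATA: **dist^{(ξ)}(X, p) OF RECORD** — on `X`'s scale the least periodic distance from `p` to a site of a cube of `X`
(`NE9KernelGeometryTorus` §2), the conventional value `D` off-scale. [cite: Balaban1987RG1, (4.22) p.286] -/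
def dXR (X : R.carriers.Dom) (p : PtR R M) : ℝ :=
  if p.1 = X.1 then X.2.1.inf' X.2.2.1 (distCT (R.cubesPerDir X.1) M (toScale R M X.1 p)) else D R M

/-- [folklore] `0 ≤ dX`. -/
theorem dXR_nonneg (X : R.carriers.Dom) (p : PtR R M) : 0 ≤ dXR R M X p := by
  unfold dXR; split_ifs; exacts [inf_distCT_nonneg _ _, D_nonneg R M]

/-! ## §3 (G) at the points of record -/

/-- **(G) AT THE POINTS OF RECORD, SAME SCALE**: for two points on `X`'s own scale the binder (G) IS the crew's
`NE9KernelGeometryTorus.geom_carriersOfRecord` (base site = `p0R X`), read through §2's definitions. [cite: Balaban1987RG1, (4.22) p.286] -/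
theorem geom_record_same {δ₀ w : ℝ} (hδ₀ : 0 ≤ δ₀) (hw : 0 ≤ w) (X : R.carriers.Dom) (s s' : TPt 4 (R.cubesPerDir X.1 * M)) :
    min (δ₀ / 2) (w / (2 * (3 * (M : ℝ) * 4))) * ρdR R M (p0R R M X) ⟨X.1, s⟩ +
        min (δ₀ / 2) (w / (2 * (3 * (M : ℝ) * 4))) * ρdR R M ⟨X.1, s⟩ ⟨X.1, s'⟩ ≤
      δ₀ * (dXR R M X ⟨X.1, s⟩ + dXR R M X ⟨X.1, s'⟩) + w * R.carriers.d X + w := by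
  have h := geom_carriersOfRecord R X (M := M) (tcubeOf_x0R R M X) hδ₀ hw s s'
  have e1 : ρdR R M (p0R R M X) ⟨X.1, s⟩ = pl1 (x0R R M X - s) := ρdR_p0R R M X s
  have e2 : ρdR R M ⟨X.1, s⟩ ⟨X.1, s'⟩ = pl1 (s - s') := ρdR_same R M X.1 s s'
  have e3 : dXR R M X ⟨X.1, s⟩ = X.2.1.inf' X.2.2.1 (distCT (R.cubesPerDir X.1) M s) := by simp [dXR]
  have e4 : dXR R M X ⟨X.1, s'⟩ = X.2.1.inf' X.2.2.1 (distCT (R.cubesPerDir X.1) M s') := by simp [dXR]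
  rw [e1, e2, e3, e4]
  exact h

/-- **(G) AT THE POINTS OF RECORD, FOR ALL POINTS**: with the crew's letters `δ₁ := min (δ₀∕2) (w∕(2·(3·M·4)))`, `w₀ := w` (unchanged),
`δ₁·ρd (p0 X) p + δ₁·ρd p q ≤ δ₀·(dX X p + dX X q) + w·d(X) + w` for every domain of the carriers of record and every two points of record —
same scale as `X`: `geom_record_same` (`NE9KernelGeometryTorus.geom_carriersOfRecord` BY NAME); a point off `X`'s scale: both sides read
the conventional value and `2δ₁ ≤ δ₀`, `ρd ≤ D`. [cite: Balaban1987RG1, (4.22) p.286] -/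
theorem geom_record {δ₀ w : ℝ} (hδ₀ : 0 ≤ δ₀) (hw : 0 ≤ w) (X : R.carriers.Dom) (p q : PtR R M) :
    min (δ₀ / 2) (w / (2 * (3 * (M : ℝ) * 4))) * ρdR R M (p0R R M X) p +
        min (δ₀ / 2) (w / (2 * (3 * (M : ℝ) * 4))) * ρdR R M p q ≤
      δ₀ * (dXR R M X p + dXR R M X q) + w * R.carriers.d X + w := by
  set δ₁ : ℝ := min (δ₀ / 2) (w / (2 * (3 * (M : ℝ) * 4))) with hδ₁def
  have hM : (0 : ℝ) < M := by exact_mod_cast Nat.pos_of_neZero M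
  have h2δ₁ : 2 * δ₁ ≤ δ₀ := two_mul_delta1_le δ₀ w _
  have hδ₁0 : 0 ≤ δ₁ := delta1_nonneg hδ₀ hw (by positivity)
  have hd : 0 ≤ R.carriers.d X := R.carriers.d_nonneg X
  have hD0 := D_nonneg R M
  by_cases hp : p.1 = X.1
  · rw [eq_mk_toScale R M hp]
    by_cases hq : q.1 = X.1
    · rw [eq_mk_toScale R M hq]
      exact geom_record_same R M hδ₀ hw X _ _
    · -- `q` off `X`'s scale: `ρd p q = dX X q = D`
      have hρ1 : ρdR R M (p0R R M X) ⟨X.1, toScale R M X.1 p⟩ ≤ D R M := ρdR_le_D R M _ _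
      have hρ2 : ρdR R M ⟨X.1, toScale R M X.1 p⟩ q = D R M := ρdR_off R M (by simpa using Ne.symm hq)
      have hdX1 : 0 ≤ dXR R M X ⟨X.1, toScale R M X.1 p⟩ := dXR_nonneg R M _ _
      have hdX2 : dXR R M X q = D R M := by simp [dXR, hq]
      rw [hρ2, hdX2]
      nlinarith [mul_le_mul_of_nonneg_left hρ1 hδ₁0]
  · -- `p` off `X`'s scale: `ρd (p0 X) p = dX X p = D`
    have hρ1 : ρdR R M (p0R R M X) p = D R M := ρdR_off R M (by simpa using Ne.symm hp)
    have hρ2 : ρdR R M p q ≤ D R M := ρdR_le_D R M _ _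
    have hdX1 : dXR R M X p = D R M := by simp [dXR, hp]
    have hdX2 : 0 ≤ dXR R M X q := dXR_nonneg R M _ _
    rw [hρ1, hdX1]
    nlinarith [mul_le_mul_of_nonneg_left hρ2 hδ₁0]

/-- **(G) IN THE FAMILY SHAPE of the END's `hgeom`** (any index families `pts` of points of record — (G) holds for all points; domains
`x.1` of `x : Dom × τ`, `τ = Bool` for the re∕im doubled carriers). [cite: Balaban1987RG1, (4.22) p.286] -/
theorem geom_record_family {ι α τ : Type*} (pts : ℕ → ι → α → Finset (PtR R M)) {δ₀ w : ℝ} (hδ₀ : 0 ≤ δ₀) (hw : 0 ≤ w) :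
    ∀ (k : ℕ) (y : ι) (a : α) (x : R.carriers.Dom × τ), ∀ p ∈ pts k y a, ∀ q ∈ pts k y a,
      min (δ₀ / 2) (w / (2 * (3 * (M : ℝ) * 4))) * ρdR R M (p0R R M x.1) p +
          min (δ₀ / 2) (w / (2 * (3 * (M : ℝ) * 4))) * ρdR R M p q ≤
        δ₀ * (dXR R M x.1 p + dXR R M x.1 q) + w * R.carriers.d x.1 + w :=
  fun _ _ _ x p _ q _ => geom_record R M hδ₀ hw x.1 p q

/-! ## §4 (S) at the points of record -/

/-- [folklore] DATA: the first sum constant of record `c₀(δ₁) := K₁ 4 δ₁ + (δ₁·e)⁻¹` (print's cube-sum constant `K₁` of (5.10) on the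
scale of the base point, plus the letters-only off-scale term). -/
def c0R (δ₁ : ℝ) : ℝ := K₁ 4 δ₁ + (δ₁ * Real.exp 1)⁻¹

/-- [folklore] DATA: the second sum constant of record `c₁(δ₁, m) := (2m∕(eδ₁))^m·K₁ 4 (δ₁∕2) + ((m+1)∕(δ₁e))^{m+1}`. -/
def c1R (δ₁ : ℝ) (m : ℕ) : ℝ :=
  (2 * m / (Real.exp 1 * δ₁)) ^ m * K₁ 4 (δ₁ / 2) + (((m + 1 : ℕ) : ℝ) / (δ₁ * Real.exp 1)) ^ (m + 1)

/-- [folklore] `hc0`: `0 ≤ c₀` (for `δ₁ > 0`). -/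
theorem c0R_nonneg {δ₁ : ℝ} (hδ₁ : 0 < δ₁) : 0 ≤ c0R δ₁ := by
  unfold c0R
  have := K₁_nonneg 4 δ₁
  positivity

/-- [folklore] `hc1`: `0 ≤ c₁` (for `δ₁ > 0`). -/
theorem c1R_nonneg {δ₁ : ℝ} (hδ₁ : 0 < δ₁) (m : ℕ) : 0 ≤ c1R δ₁ m := by
  unfold c1R
  have := K₁_nonneg 4 (δ₁ / 2)
  positivity

/-- [folklore] The off-scale tail: `V·D^n·e^{−δ₁D} ≤ (↑(n+1)∕(δ₁e))^{n+1}` (`V ≤ D` and `t^{n+1}e^{−δ₁t} ≤ ((n+1)∕(δ₁e))^{n+1}`). -/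
theorem offScale_tail_le {δ₁ : ℝ} (hδ₁ : 0 < δ₁) (n : ℕ) :
    (V R M : ℝ) * (D R M ^ n * Real.exp (-(δ₁ * D R M))) ≤ (((n + 1 : ℕ) : ℝ) / (δ₁ * Real.exp 1)) ^ (n + 1) := by
  have hD := D_nonneg R M
  have hV := V_le_D R M
  have hV0 : (0 : ℝ) ≤ V R M := Nat.cast_nonneg _
  have hexp : 0 ≤ D R M ^ n * Real.exp (-(δ₁ * D R M)) := by positivity
  calc (V R M : ℝ) * (D R M ^ n * Real.exp (-(δ₁ * D R M)))
      ≤ D R M * (D R M ^ n * Real.exp (-(δ₁ * D R M))) := mul_le_mul_of_nonneg_right hV hexp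
    _ = D R M ^ (n + 1) * Real.exp (-(δ₁ * D R M)) := by ring
    _ ≤ (((n + 1 : ℕ) : ℝ) / (δ₁ * Real.exp 1)) ^ (n + 1) := pow_mul_exp_neg_le (n + 1) hδ₁ hD

/-- **THE FIRST LATTICE SUM (S) AT THE POINTS OF RECORD**: for `δ₁ > 0` and EVERY domain `X` of the carriers of record,
`Σ_{p ∈ ptsR} e^{−δ₁·ρd (p0 X) p} ≤ c₀(δ₁) = K₁ 4 δ₁ + (δ₁e)⁻¹` — the fibre of `X`'s scale is the crew's torus sum
(`sum_exp_neg_pl1_le_K₁` BY NAME), the other fibres read `e^{−δ₁D}` each, `V` times in all. [cite: Balaban1987RG1, (4.21)-(4.22) pp.285-286] -/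
theorem sum0_record {δ₁ : ℝ} (hδ₁ : 0 < δ₁) (X : R.carriers.Dom) :
    ∑ p ∈ ptsR R M, Real.exp (-(δ₁ * ρdR R M (p0R R M X) p)) ≤ c0R δ₁ := by
  classical
  rw [ptsR, Finset.sum_sigma]
  -- fibrewise bound
  have key : ∀ j ∈ scales R,
      ∑ s : TPt 4 (R.cubesPerDir j * M), Real.exp (-(δ₁ * ρdR R M (p0R R M X) ⟨j, s⟩)) ≤
        (if j = X.1 then K₁ 4 δ₁ else 0) + (Fintype.card (TPt 4 (R.cubesPerDir j * M)) : ℝ) * Real.exp (-(δ₁ * D R M)) := by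
    intro j _
    by_cases hj : j = X.1
    · rw [if_pos hj]
      subst hj
      have h := sum_exp_neg_pl1_le_K₁ (d := 4) hδ₁ (Finset.univ : Finset (TPt 4 (R.cubesPerDir X.1 * M))) (x0R R M X)
      have hnn : (0 : ℝ) ≤ (Fintype.card (TPt 4 (R.cubesPerDir X.1 * M)) : ℝ) * Real.exp (-(δ₁ * D R M)) := by positivity
      have h' : ∑ s : TPt 4 (R.cubesPerDir X.1 * M), Real.exp (-(δ₁ * ρdR R M (p0R R M X) ⟨X.1, s⟩)) =
          ∑ s : TPt 4 (R.cubesPerDir X.1 * M), Real.exp (-(δ₁ * pl1 (x0R R M X - s))) :=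
        Finset.sum_congr rfl fun s _ => by rw [ρdR_p0R]
      rw [h']
      linarith
    · rw [if_neg hj, zero_add]
      have h' : ∀ s : TPt 4 (R.cubesPerDir j * M), Real.exp (-(δ₁ * ρdR R M (p0R R M X) ⟨j, s⟩)) = Real.exp (-(δ₁ * D R M)) := by
        intro s
        rw [ρdR_off R M (by simpa using Ne.symm hj)]
      simp only [h', Finset.sum_const, Finset.card_univ, nsmul_eq_mul, le_refl]
  refine (Finset.sum_le_sum key).trans ?_
  rw [Finset.sum_add_distrib, Finset.sum_ite_eq' (scales R) X.1 (fun _ => K₁ 4 δ₁), ← Finset.sum_mul, ← V_eq_sum]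
  have hK : (if X.1 ∈ scales R then K₁ 4 δ₁ else 0) ≤ K₁ 4 δ₁ := by
    split_ifs
    · exact le_rfl
    · exact K₁_nonneg 4 δ₁
  have htail := offScale_tail_le R M hδ₁ 0
  simp only [pow_zero, one_mul, zero_add, Nat.cast_one, pow_one, one_div] at htail
  unfold c0R
  linarith

/-- **THE SECOND LATTICE SUM (S) AT THE POINTS OF RECORD**: for `δ₁ > 0`, every power `m` and EVERY point `p` of record type,
`Σ_{q ∈ ptsR} ρd(p,q)^m·e^{−δ₁·ρd(p,q)} ≤ c₁(δ₁, m) = (2m∕(eδ₁))^m·K₁ 4 (δ₁∕2) + ((m+1)∕(δ₁e))^{m+1}` — the fibre of `p`'s scale is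
the crew's `sum_pow_mul_exp_neg_pl1_le` BY NAME, the other fibres read `D^m e^{−δ₁D}` each. [cite: Balaban1987RG1, (4.21)-(4.22) pp.285-286] -/
theorem sum1_record {δ₁ : ℝ} (hδ₁ : 0 < δ₁) (m : ℕ) (p : PtR R M) :
    ∑ q ∈ ptsR R M, ρdR R M p q ^ m * Real.exp (-(δ₁ * ρdR R M p q)) ≤ c1R δ₁ m := by
  classical
  rw [ptsR, Finset.sum_sigma]
  have key : ∀ j ∈ scales R,
      ∑ s : TPt 4 (R.cubesPerDir j * M), ρdR R M p ⟨j, s⟩ ^ m * Real.exp (-(δ₁ * ρdR R M p ⟨j, s⟩)) ≤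
        (if j = p.1 then (2 * m / (Real.exp 1 * δ₁)) ^ m * K₁ 4 (δ₁ / 2) else 0) +
          (Fintype.card (TPt 4 (R.cubesPerDir j * M)) : ℝ) * (D R M ^ m * Real.exp (-(δ₁ * D R M))) := by
    intro j _
    by_cases hj : j = p.1
    · rw [if_pos hj]
      subst hj
      have h := sum_pow_mul_exp_neg_pl1_le (d := 4) hδ₁ m (Finset.univ : Finset (TPt 4 (R.cubesPerDir p.1 * M))) p.2
      have hnn : (0 : ℝ) ≤ (Fintype.card (TPt 4 (R.cubesPerDir p.1 * M)) : ℝ) * (D R M ^ m * Real.exp (-(δ₁ * D R M))) := by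
        have := D_nonneg R M
        positivity
      have h' : ∑ s : TPt 4 (R.cubesPerDir p.1 * M), ρdR R M p ⟨p.1, s⟩ ^ m * Real.exp (-(δ₁ * ρdR R M p ⟨p.1, s⟩)) =
          ∑ s : TPt 4 (R.cubesPerDir p.1 * M), pl1 (p.2 - s) ^ m * Real.exp (-(δ₁ * pl1 (p.2 - s))) := by
        refine Finset.sum_congr rfl fun s _ => ?_
        simp [ρdR]
      rw [h']
      linarith
    · rw [if_neg hj, zero_add]
      have h' : ∀ s : TPt 4 (R.cubesPerDir j * M),
          ρdR R M p ⟨j, s⟩ ^ m * Real.exp (-(δ₁ * ρdR R M p ⟨j, s⟩)) = D R M ^ m * Real.exp (-(δ₁ * D R M)) := by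
        intro s
        rw [ρdR_off R M (by simpa using Ne.symm hj)]
      simp only [h', Finset.sum_const, Finset.card_univ, nsmul_eq_mul, le_refl]
  refine (Finset.sum_le_sum key).trans ?_
  rw [Finset.sum_add_distrib, Finset.sum_ite_eq' (scales R) p.1 (fun _ => (2 * m / (Real.exp 1 * δ₁)) ^ m * K₁ 4 (δ₁ / 2)),
    ← Finset.sum_mul, ← V_eq_sum]
  have hK : (if p.1 ∈ scales R then (2 * m / (Real.exp 1 * δ₁)) ^ m * K₁ 4 (δ₁ / 2) else 0) ≤
      (2 * m / (Real.exp 1 * δ₁)) ^ m * K₁ 4 (δ₁ / 2) := by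
    split_ifs
    · exact le_rfl
    · have := K₁_nonneg 4 (δ₁ / 2)
      positivity
  have htail := offScale_tail_le R M hδ₁ m
  unfold c1R
  linarith

/-- **`hsum0` IN THE FAMILY SHAPE of the END** with `pts := fun _ _ _ => ptsR R M`. [cite: Balaban1987RG1, (4.21)-(4.22) pp.285-286] -/
theorem sum0_record_family {ι α : Type*} {δ₁ : ℝ} (hδ₁ : 0 < δ₁) :
    ∀ (k : ℕ) (y : ι) (a : α) (X : R.carriers.Dom),
      ∑ p ∈ (fun (_ : ℕ) (_ : ι) (_ : α) => ptsR R M) k y a, Real.exp (-(δ₁ * ρdR R M (p0R R M X) p)) ≤ c0R δ₁ :=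
  fun _ _ _ X => sum0_record R M hδ₁ X

/-- **`hsum1` IN THE FAMILY SHAPE of the END** with `pts := fun _ _ _ => ptsR R M`. [cite: Balaban1987RG1, (4.21)-(4.22) pp.285-286] -/
theorem sum1_record_family {ι α : Type*} {δ₁ : ℝ} (hδ₁ : 0 < δ₁) (m : ℕ) :
    ∀ (k : ℕ) (y : ι) (a : α), ∀ p ∈ (fun (_ : ℕ) (_ : ι) (_ : α) => ptsR R M) k y a,
      ∑ q ∈ (fun (_ : ℕ) (_ : ι) (_ : α) => ptsR R M) k y a, ρdR R M p q ^ m * Real.exp (-(δ₁ * ρdR R M p q)) ≤ c1R δ₁ m :=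
  fun _ _ _ p _ => sum1_record R M hδ₁ m p

/-- **THE LETTER `δ₁` IS POSITIVE AND `≤ w∕(24M)`** for `δ₀, w > 0` (print: «δ₁ = O(M⁻¹)»; `NE9KernelGeometryLattice.delta1_lattice_pos_le`
at `d = 4`, restated at the letter of §3 for the consumer's `hsum0 ∕ hsum1`, which need `0 < δ₁`). [cite: Balaban1987RG1, (4.22) p.286] -/
theorem delta1_record_pos {δ₀ w : ℝ} (hδ₀ : 0 < δ₀) (hw : 0 < w) :
    0 < min (δ₀ / 2) (w / (2 * (3 * (M : ℝ) * 4))) ∧ min (δ₀ / 2) (w / (2 * (3 * (M : ℝ) * 4))) ≤ w / (24 * M) := by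
  have hM : (0 : ℝ) < M := by exact_mod_cast Nat.pos_of_neZero M
  refine ⟨lt_min (by linarith) (by positivity), (min_le_right _ _).trans (le_of_eq ?_)⟩
  ring

end Summit.QuantumFields.BalabanUV.T4Continuum.NE9KernelPointsOfRecord

end
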